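import Summits.QuantumFields.YangMills.Theorems.BalabanUVNodesN15TwoSpacingGluingRecordKnitRightRowsTorus
import HarnessLib

/-!
# THE GLUING STEP AT TWO LATTICE SPACINGS, LXII: THE ADJOINT REMAINDER `R̃` OF THE COVER ON THE TORUS OF RECORD, BOTH SPACINGS — `R̃ ≤ (κ∕L^s)·e^{−δ|y−y′|_T}`, VOLUME FREE
# (dag-n15-c g14, FILE 104; N15 = NE2, s1 «background-layer OPERATOR ingredient»)

Cell `pub-ymgap`, seat `pub-ymgap-dag-n15-c` (R134 (a); HUMAN RULING D-0062), generation 14.  `bears_on: R4∕N15 · K3⁸ SpineGivenEndpointR13SepCoPHV (stmt-QuantumFields-27366)`.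
Filed `--supports stmt-QuantumFields-27366 --as helper` — COUNT-NEUTRAL.  Theorems only (0 `def`, 0 `sorry`).  Imports BY NAME FILE 103 `…RecordKnitRightRowsTorus` (★★★ `hasMaj_chiCube_knitGR_comp_commOp_deltaOp_pair`;
through it FILE 94 `remainderL_cut`, FILE 57 `hasMaj_remainderL_out`, FILE 65 `hcube_cut`, FILE 67 `abs_coverH_le_one`, FILE 72 `chiCube_coverCorner_eq_one_side` ∕ `sum_ind_cubeBlocks_le_overlap`, FILE 73
`knitHR` ∕ `knitGR` ∕ `MP_eq_two_mul` ∕ `coverMargin_fit`); nothing in the tree is modified.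

WHAT.  ★★★ **`hasMaj_remainderLR_knit_pair`** — the record twin of FILE 95 `hasMaj_remainderL_knit_pair`: for odd `L ≥ 3`, `a > 0` there are `δ > 0`, `κ ≥ 0` such that for every cube exponent `s`,
volume exponent `m_T ≥ s + 1`, coarse scale `K ≥ 1` and refinement `r`, on the torus of record `MP (paramsOf d L m_T K hL)` with FILE 73's cover (`(2L^{m_T−s})^{d+1}` LIFTED cubes of side
`L^{s+1}`, true overlap `(L+1)^{d+1}`, partition `knitHR`):
  `R̃ = remainderL Δ_a h G ≤ (κ∕L^s)·e^{−δ|y−y′|_T}`  at the coarse spacing `L^{−K}` AND at the fine spacing `L^{−(K+r)}`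
— rows 7, 8 of FILE 50's `GluedLetters` with `θ = κ∕M`, `M = L^s` LIVE and the VOLUME `m_T` FREE: FILE 103's per-cube rows summed over the cover by FILE 57 `hasMaj_remainderL_out`
(`|h| ≤ 1`, overlap FILE 72 `sum_ind_cubeBlocks_le_overlap`), the cut invisible (FILE 94 `remainderL_cut`, FILE 65 `hcube_cut`, FILE 72 `chiCube_coverCorner_eq_one_side`).

HONEST FRAMING ∕ LIMITS.  Block-majorant bookkeeping over LANDED rows; `U ≡ 1` MODEL of [B6] §2's machine on the torus of record (cube letters from each cube's own doubled torus via
dag-n15-a's programme P: not circular in the volume); constants crude and ours; nothing of [B5]∕[B6] (2.38)–(2.40)∕[B9] Thm 3.1, 3.14 asserted.  NE2⁺ NOT PRINTED, NOT proved; N15 NOT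
discharged; counts of record UNMOVED (typed 28∕28 · discharged 5∕27); one finite 𝕋⁴ at fixed ε per index — NOT infinite volume, NOT OS on ℝ⁴, NOT a mass gap, NOT Clay; R4 closes
`BalabanLadder.UV` only.  Restate-immune (no Theses import).
-/

noncomputable section

namespace Summit.QuantumFields.YangMills.BalabanUVNodes.N15.Gluing

open Literature.MathematicalPhysics.QuantumFieldTheory.Balaban1983to89
open Literature.MathematicalPhysics.QuantumFieldTheory.Balaban1983to89.B5Prop11Plancherel (Tor fine)
open Literature.MathematicalPhysics.QuantumFieldTheory.Balaban1983to89.B11SectG (BlockNorm HasMaj)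
open Literature.MathematicalPhysics.QuantumFieldTheory.Balaban1983to89.B6Prop26Gluing (mulOp ind ind_nonneg ind_le_one)
open Literature.MathematicalPhysics.QuantumFieldTheory.Balaban1983to89.B6UnitTorusCarrier (unitTorusGeo)
open Literature.MathematicalPhysics.QuantumFieldTheory.Balaban1983to89.B5SiteBridgeP12 (MP)
open Literature.MathematicalPhysics.QuantumFieldTheory.King1986.Torus (blockOf tdistT tdistT_nonneg)
open Summit.QuantumFields.YangMills.BalabanUVNodes.N15.VectorPiece (bshiftEquiv)
open Summit.QuantumFields.YangMills.BalabanUVNodes.N15.TwoGrid (paramsOf deltaOp chiCube cubeBlocks)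

variable {d : ℕ} {L : ℕ} [NeZero L]

/-- ★★★ **THE ADJOINT REMAINDER OF THE COVER's PARAMETRIX ON THE TORUS OF RECORD, BOTH SPACINGS, VOLUME FREE** — the record twin of FILE 95 `hasMaj_remainderL_knit_pair`: for odd
`L ≥ 3`, `a > 0` there are `δ > 0`, `κ ≥ 0` with, for all `s`, `m_T ≥ s + 1`, `K ≥ 1`, `r`, on `MP (paramsOf d L m_T K hL)` (FILE 73's cover: lifted cubes `knitGR` of side `L^{s+1}`, partition
`knitHR`, `w = L^s`, `q = L^{m_T−s}`): `remainderL Δ_a h G ≤ (κ∕L^s)·e^{−δ|y−y′|_T}` at the coarse spacing `L^{−K}` AND at the fine spacing `L^{−(K+r)}` — FILE 103's per-cube rows, FILE 94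
`remainderL_cut` (the cut is invisible: FILE 65 `hcube_cut`, FILE 72 `chiCube_coverCorner_eq_one_side`), FILE 57 `hasMaj_remainderL_out` with the true overlap `(L+1)^{d+1}` (FILE 72
`sum_ind_cubeBlocks_le_overlap`) and `|h| ≤ 1` (FILE 67). [cite: Balaban1984PropagatorsII, (2.91)–(2.93) p.239, (2.134)–(2.135) p.247 (shapes + mechanism, transposed); Balaban1984PropagatorsI,
Prop. 1.2 (1.110) p.35, (1.126) p.38, p.39] -/
theorem hasMaj_remainderLR_knit_pair (hL : Odd L ∧ 1 < L) {a : ℝ} (ha : 0 < a) :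
    ∃ δ κ : ℝ, 0 < δ ∧ 0 ≤ κ ∧ ∀ (s mT K r : ℕ) (hs : s + 1 ≤ mT) (_hK : 1 ≤ K),
      HasMaj (BlockNorm.ofBlocks (unitTorusGeo L K (MP (paramsOf d L mT K hL)))
          (fun b : Tor (fine (L ^ K) (MP (paramsOf d L mT K hL))) × Fin (d + 1) => blockOf (L ^ K) (MP (paramsOf d L mT K hL)) b.1))
        (BlockNorm.ofBlocks (unitTorusGeo L K (MP (paramsOf d L mT K hL)))
          (fun b : Tor (fine (L ^ K) (MP (paramsOf d L mT K hL))) × Fin (d + 1) => blockOf (L ^ K) (MP (paramsOf d L mT K hL)) b.1))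
        (remainderL (deltaOp (MP (paramsOf d L mT K hL)) (L ^ K) a) (knitHR d L s mT K (L ^ K) hL) (knitGR d L s mT K (L ^ K) hL hs a))
        (fun y y' => κ / (L : ℝ) ^ s * Real.exp (-(δ * tdistT (MP (paramsOf d L mT K hL)) y y'))) ∧
      HasMaj (BlockNorm.ofBlocks (unitTorusGeo L K (MP (paramsOf d L mT K hL)))
          (fun x : Tor (fine (L ^ r * L ^ K) (MP (paramsOf d L mT K hL))) × Fin (d + 1) => blockOf (L ^ r * L ^ K) (MP (paramsOf d L mT K hL)) x.1))
        (BlockNorm.ofBlocks (unitTorusGeo L K (MP (paramsOf d L mT K hL)))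
          (fun x : Tor (fine (L ^ r * L ^ K) (MP (paramsOf d L mT K hL))) × Fin (d + 1) => blockOf (L ^ r * L ^ K) (MP (paramsOf d L mT K hL)) x.1))
        (remainderL (deltaOp (MP (paramsOf d L mT K hL)) (L ^ r * L ^ K) a) (knitHR d L s mT K (L ^ r * L ^ K) hL) (knitGR d L s mT K (L ^ r * L ^ K) hL hs a))
        (fun y y' => κ / (L : ℝ) ^ s * Real.exp (-(δ * tdistT (MP (paramsOf d L mT K hL)) y y'))) := by
  have hL3 : 3 ≤ L := by obtain ⟨⟨j, hj⟩, h1⟩ := hL; omega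
  have hLpos : 0 < L := by omega
  obtain ⟨δ, Θ₀, hδ, hΘ₀, HK⟩ := hasMaj_chiCube_knitGR_comp_commOp_deltaOp_pair (d := d) hL ha
  refine ⟨δ, ((((L + 1) ^ (d + 1) : ℕ) : ℝ)) * Θ₀, hδ, by positivity, fun s mT K r hs hK => ?_⟩
  -- the index's data
  have hs' : s ≤ mT := by omega
  have hM : ∀ ν, MP (paramsOf d L mT K hL) ν = 2 * L ^ (mT - s) * L ^ s := MP_eq_two_mul L s mT K hL hs'
  have hw : 0 < L ^ s := pow_pos hLpos s
  have hfit := coverMargin_fit hL3 s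
  have hSe : L ^ (s + 1) = L * L ^ s := by rw [pow_succ, mul_comm]
  have hfit1 : coverMargin L s + 2 * L ^ s + 1 ≤ L ^ (s + 1) := by rw [hSe]; omega
  have hS : L ^ (s + 1) ≤ 2 * L ^ (mT - s) * L ^ s := by
    calc L ^ (s + 1) ≤ L ^ mT := Nat.pow_le_pow_right hLpos hs
      _ = L ^ (mT - s) * L ^ s := by rw [← pow_add]; congr 1; omega
      _ ≤ 2 * L ^ (mT - s) * L ^ s := by rw [mul_assoc]; omega
  have hwcast : ((L ^ s : ℕ) : ℝ) = (L : ℝ) ^ s := Nat.cast_pow L s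
  have hxs : (0 : ℝ) < (L : ℝ) ^ s := by rw [← hwcast]; exact_mod_cast hw
  have hθ : 0 ≤ Θ₀ / (L : ℝ) ^ s := div_nonneg hΘ₀ hxs.le
  have hdiv : L ^ (s + 1) / L ^ s + 1 = L + 1 := by rw [hSe, Nat.mul_div_cancel _ hw]
  -- the cut does not see `R̃`; the partition is bounded by one; the true overlap
  have hone := fun (n : ℕ) [NeZero n] (k : Fin (d + 1) → ZMod (2 * L ^ (mT - s))) =>
    chiCube_coverCorner_eq_one_side (M := MP (paramsOf d L mT K hL)) (n := n) (m₀ := coverMargin L s) hM hw hfit1 hS 0 k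
  have hcut : ∀ (n : ℕ) [NeZero n] (k : Fin (d + 1) → ZMod (2 * L ^ (mT - s))), mulOp (knitHR d L s mT K n hL k) ∘ₗ
      mulOp (chiCube (MP (paramsOf d L mT K hL)) n (coverCorner (MP (paramsOf d L mT K hL)) (L ^ s) (L ^ (mT - s)) (coverMargin L s) k) (L ^ (s + 1))) =
      mulOp (knitHR d L s mT K n hL k) := fun n _ k =>
    hcube_cut (2 * L ^ (mT - s)) (coverXi (MP (paramsOf d L mT K hL)) n (L ^ s)) (bshiftEquiv (MP (paramsOf d L mT K hL)) n) 0 (hone n k)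
  have hh : ∀ (n : ℕ) [NeZero n] (k : Fin (d + 1) → ZMod (2 * L ^ (mT - s))) (x : Tor (fine n (MP (paramsOf d L mT K hL))) × Fin (d + 1)), |knitHR d L s mT K n hL k x| ≤ 1 :=
    fun n _ k x => abs_coverH_le_one k x
  have hN : ∀ y : Tor (MP (paramsOf d L mT K hL)), ∑ k : Fin (d + 1) → ZMod (2 * L ^ (mT - s)),
      ind (g := unitTorusGeo L K (MP (paramsOf d L mT K hL)))
        ((cubeBlocks (MP (paramsOf d L mT K hL)) (coverCorner (MP (paramsOf d L mT K hL)) (L ^ s) (L ^ (mT - s)) (coverMargin L s) k) (L ^ (s + 1)) : Finset _) : Set _) y ≤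
      (((L + 1) ^ (d + 1) : ℕ) : ℝ) := fun y => by
    have h := sum_ind_cubeBlocks_le_overlap (S := L ^ (s + 1)) (m₀ := coverMargin L s) hM hw L K y
    rw [hdiv] at h
    exact h
  constructor
  · have hR := hasMaj_remainderL_out (g := unitTorusGeo L K (MP (paramsOf d L mT K hL)))
      (fun b : Tor (fine (L ^ K) (MP (paramsOf d L mT K hL))) × Fin (d + 1) => blockOf (L ^ K) (MP (paramsOf d L mT K hL)) b.1)
      (fun k => ((cubeBlocks (MP (paramsOf d L mT K hL)) (coverCorner (MP (paramsOf d L mT K hL)) (L ^ s) (L ^ (mT - s)) (coverMargin L s) k) (L ^ (s + 1)) : Finset _) : Set _))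
      (Δ := deltaOp (MP (paramsOf d L mT K hL)) (L ^ K) a) (h := knitHR d L s mT K (L ^ K) hL)
      (G := fun k => mulOp (chiCube (MP (paramsOf d L mT K hL)) (L ^ K) (coverCorner (MP (paramsOf d L mT K hL)) (L ^ s) (L ^ (mT - s)) (coverMargin L s) k) (L ^ (s + 1))) ∘ₗ
        knitGR d L s mT K (L ^ K) hL hs a k) hθ (hh (L ^ K)) hN (fun k => (HK s mT K r hs hK k).1)
    rw [remainderL_cut (hcut (L ^ K))] at hR
    exact hR.mono fun y y' => mul_le_mul_of_nonneg_right (le_of_eq (mul_div_assoc _ _ _).symm) (Real.exp_nonneg _)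
  · have hR := hasMaj_remainderL_out (g := unitTorusGeo L K (MP (paramsOf d L mT K hL)))
      (fun x : Tor (fine (L ^ r * L ^ K) (MP (paramsOf d L mT K hL))) × Fin (d + 1) => blockOf (L ^ r * L ^ K) (MP (paramsOf d L mT K hL)) x.1)
      (fun k => ((cubeBlocks (MP (paramsOf d L mT K hL)) (coverCorner (MP (paramsOf d L mT K hL)) (L ^ s) (L ^ (mT - s)) (coverMargin L s) k) (L ^ (s + 1)) : Finset _) : Set _))
      (Δ := deltaOp (MP (paramsOf d L mT K hL)) (L ^ r * L ^ K) a) (h := knitHR d L s mT K (L ^ r * L ^ K) hL)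
      (G := fun k => mulOp (chiCube (MP (paramsOf d L mT K hL)) (L ^ r * L ^ K) (coverCorner (MP (paramsOf d L mT K hL)) (L ^ s) (L ^ (mT - s)) (coverMargin L s) k) (L ^ (s + 1))) ∘ₗ
        knitGR d L s mT K (L ^ r * L ^ K) hL hs a k) hθ (hh (L ^ r * L ^ K)) hN (fun k => (HK s mT K r hs hK k).2)
    rw [remainderL_cut (hcut (L ^ r * L ^ K))] at hR
    exact hR.mono fun y y' => mul_le_mul_of_nonneg_right (le_of_eq (mul_div_assoc _ _ _).symm) (Real.exp_nonneg _)

end Summit.QuantumFields.YangMills.BalabanUVNodes.N15.Gluing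

end
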